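import Mathlib

/-!
# Crux `TateFamilyKernel` (stmt-KontsevichZagierPeriods-9130), line `Sketch`: `stub_linMomentsW`

Step 1 (MOMENTS) of the linear class WITH A `ϖ`-DEPENDENT NUMERATOR of the lead's skeleton of the
crux `Summit.KontsevichZagierPeriods.KontsevichZagierPeriods.Theses.InverseLandau.TateFamilyKernel`:
the Tate denominator `Q = 1 − ϖT`, `T = (α + βz₂)z₁` (`0 < α`, `0 < β`; variables `X 0 = z₁`,
`X 1 = z₂`, `X (Fin.last 2) = ϖ`) and an arbitrary numerator `P ∈ ℚ[z₁, z₂, ϖ]`. If `Q ≠ 0` on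
`[0,1]² × (0,b)` and the open-square fibre integrals `∫ P(·,ϖ)/Q(·,ϖ)` vanish for all
`ϖ ∈ (0,b)`, then the REVERSED polynomial `P̃ = Σ_d c_d z^{d'} T^{M₀ − d_ϖ}` (sum over the
monomials `c_d z^{d'} ϖ^{d_ϖ}` of `P`, `M₀ = deg_ϖ P`) satisfies `P̃(z) = T^{M₀} P(z, 1/T)` wherever
`T ≠ 0`, and all its moments `∫_{(0,1)²} P̃ T^M` vanish.

* Admissibility forces `ϖ(α+β) < 1` on `(0,b)` (else the corner `z = (1,1)` and
  `ϖ₁ = 1/(α+β) ∈ (0,b)` give `Q = 0`), so on the square `0 ≤ ϖT ≤ ϖ(α+β) < 1`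
  (`LinMomentsW.T_bounds_Icc`) and each monomial contributes the shifted geometric series
  `c_d z^{d'} ϖ^{d_ϖ} Σ_i (ϖT)^i = Σ_{M ≥ d_ϖ} c_d z^{d'} T^{M−d_ϖ} ϖ^M`
  (`LinMomentsW.hasSum_shift_geometric`); summing over the monomials,
  `P(z,ϖ)/Q(z,ϖ) = Σ_M F_M(z) ϖ^M` with `F_M = Σ_{d : d_ϖ ≤ M} c_d z^{d'} T^{M−d_ϖ}` and the
  uniform bound `|F_M| ≤ K (α+β)^M` on the square (`LinMomentsW.abs_sum_shift_le`).
* Dominated convergence for series gives `0 = ∫ P/Q(·,ϖ) = Σ_M (∫ F_M) ϖ^M` on `(0,b)`, and a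
  real power series with coefficients `O((α+β)^M)` vanishing on `(0,b)` is zero (isolated
  zeros), so `∫ F_M = 0` for all `M` (`LinMomentsW.integral_coeff_eq_zero`).
* For every `M`, `F_{M+M₀} = P̃ · T^M` identically (all `d_ϖ ≤ M₀`), whence the moments of `P̃`.

The file is self-contained (Mathlib only): the module of the landed `ϖ`-free step
`…StubLinMoments` (helpers `LinMoments.*`: the same uniqueness / dominated-convergence argument for
a `ϖ`-free numerator) was not yet served by the farm when this file was written, so its two
analytic steps are re-proved here inside `LinMomentsW.integral_coeff_eq_zero` rather than
imported. No named fact, no new definition.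
-/

noncomputable section

open MeasureTheory Set MvPolynomial
open scoped Topology

namespace Summit.KontsevichZagierPeriods.InverseLandau.TateFamilyKernel.Descent

namespace LinMomentsW

/-! ### Evaluations -/

/-- **Monomial expansion** of `P(z, y)`: `P(z, y) = Σ_d c_d z^{d'} y^{d_ϖ}` over the support of
`P`, `d' = d ∘ castSucc`, `d_ϖ = d (last 2)`. [folklore] -/
theorem aeval_snoc_eq_sum (P : MvPolynomial (Fin (2 + 1)) ℚ) (z : Fin 2 → ℝ) (y : ℝ) :
    aeval (Fin.snoc z y : Fin (2 + 1) → ℝ) P =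
      ∑ d ∈ P.support, ((coeff d P : ℚ) : ℝ) *
        (∏ i : Fin 2, z i ^ d (Fin.castSucc i)) * y ^ d (Fin.last 2) := by
  rw [aeval_def, eval₂_eq']
  refine Finset.sum_congr rfl fun d _ => ?_
  rw [Fin.prod_univ_castSucc, ← mul_assoc]
  simp only [Fin.snoc_castSucc, Fin.snoc_last, eq_ratCast]

/-- **Evaluation of the reversed polynomial** `Σ_d c_d X^{d'} T^{M₀ − d_ϖ}`,
`T = (C α + C β X₁) X₀`, at a real point. [folklore] -/
theorem aeval_rev (α β : ℚ) (P : MvPolynomial (Fin (2 + 1)) ℚ) (M₀ : ℕ) (z : Fin 2 → ℝ) :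
    aeval z (∑ d ∈ P.support, C (coeff d P) * (∏ i : Fin 2, X i ^ d (Fin.castSucc i)) *
        ((C α + C β * X 1) * X 0) ^ (M₀ - d (Fin.last 2))) =
      ∑ d ∈ P.support, ((coeff d P : ℚ) : ℝ) * (∏ i : Fin 2, z i ^ d (Fin.castSucc i)) *
        (((α : ℝ) + β * z 1) * z 0) ^ (M₀ - d (Fin.last 2)) := by
  simp only [map_sum, map_mul, map_pow, map_prod, map_add, aeval_X, aeval_C, eq_ratCast]

/-! ### The shifted geometric series of one monomial -/

/-- **Shifted geometric series**: for `0 ≤ ϖt < 1`,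
`Σ_{M ≥ e} a t^{M−e} ϖ^M = a ϖ^e (1 − ϖt)⁻¹`. [folklore] -/
theorem hasSum_shift_geometric {a t ϖ : ℝ} (e : ℕ) (ht : 0 ≤ ϖ * t) (ht1 : ϖ * t < 1) :
    HasSum (fun M : ℕ => (if e ≤ M then a * t ^ (M - e) else 0) * ϖ ^ M)
      (a * ϖ ^ e * (1 - ϖ * t)⁻¹) := by
  refine (hasSum_nat_add_iff' e).mp ?_
  have h0 : ∑ i ∈ Finset.range e, (if e ≤ i then a * t ^ (i - e) else 0) * ϖ ^ i = 0 :=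
    Finset.sum_eq_zero fun i hi => by
      rw [if_neg (not_le.mpr (Finset.mem_range.mp hi)), zero_mul]
  rw [h0, sub_zero]
  have hfun : (fun n : ℕ => (if e ≤ n + e then a * t ^ (n + e - e) else 0) * ϖ ^ (n + e)) =
      fun n : ℕ => a * ϖ ^ e * (ϖ * t) ^ n := by
    funext n
    rw [if_pos (Nat.le_add_left e n), Nat.add_sub_cancel, pow_add, mul_pow]
    ring
  rw [hfun]
  exact (hasSum_geometric_of_lt_one ht ht1).mul_left (a * ϖ ^ e)

/-! ### Finite-sum identities and bounds for the shifted coefficients -/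

/-- **Pointwise expansion**: summing the shifted geometric series of finitely many monomials,
`Σ_M (Σ_{i : e_i ≤ M} a_i t^{M−e_i}) ϖ^M = (Σ_i a_i ϖ^{e_i}) (1 − ϖt)⁻¹` for `0 ≤ ϖt < 1`.
[folklore] -/
theorem hasSum_sum_shift {ι : Type*} (s : Finset ι) (a : ι → ℝ) (e : ι → ℕ) {t ϖ : ℝ}
    (ht : 0 ≤ ϖ * t) (ht1 : ϖ * t < 1) :
    HasSum (fun M : ℕ => (∑ i ∈ s, if e i ≤ M then a i * t ^ (M - e i) else 0) * ϖ ^ M)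
      ((∑ i ∈ s, a i * ϖ ^ e i) * (1 - ϖ * t)⁻¹) := by
  simp_rw [Finset.sum_mul]
  exact hasSum_sum fun i _ => hasSum_shift_geometric (e i) ht ht1

/-- **Geometric bound** on the shifted coefficients: if `|a_i| ≤ A_i` and `0 ≤ t ≤ R` (`0 < R`),
then `|Σ_{i : e_i ≤ M} a_i t^{M−e_i}| ≤ (Σ_i A_i R^{−e_i}) R^M`. [folklore] -/
theorem abs_sum_shift_le {ι : Type*} (s : Finset ι) (a A : ι → ℝ) (e : ι → ℕ) {t R : ℝ}
    (hR : 0 < R) (ht0 : 0 ≤ t) (htR : t ≤ R) (ha : ∀ i ∈ s, |a i| ≤ A i) (M : ℕ) :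
    |∑ i ∈ s, (if e i ≤ M then a i * t ^ (M - e i) else 0)| ≤
      (∑ i ∈ s, A i * (R ^ e i)⁻¹) * R ^ M := by
  rw [Finset.sum_mul]
  refine (Finset.abs_sum_le_sum_abs _ _).trans (Finset.sum_le_sum fun i hi => ?_)
  have hA : 0 ≤ A i := (abs_nonneg _).trans (ha i hi)
  split_ifs with h
  · rw [abs_mul, abs_pow, abs_of_nonneg ht0]
    calc |a i| * t ^ (M - e i) ≤ A i * R ^ (M - e i) :=
          mul_le_mul (ha i hi) (pow_le_pow_left₀ ht0 htR _) (pow_nonneg ht0 _) hA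
      _ = A i * (R ^ e i)⁻¹ * R ^ M := by rw [pow_sub₀ _ hR.ne' h]; ring
  · rw [abs_zero]
    exact mul_nonneg (mul_nonneg hA (inv_nonneg.mpr (pow_nonneg hR.le _))) (pow_nonneg hR.le _)

/-- **High coefficients are moments of the reversal**: if all `e_i ≤ M₀`, then
`Σ_{i : e_i ≤ M+M₀} a_i t^{M+M₀−e_i} = (Σ_i a_i t^{M₀−e_i}) t^M`. [folklore] -/
theorem sum_shift_eq {ι : Type*} (s : Finset ι) (a : ι → ℝ) (e : ι → ℕ) (t : ℝ) {M₀ : ℕ}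
    (he : ∀ i ∈ s, e i ≤ M₀) (M : ℕ) :
    ∑ i ∈ s, (if e i ≤ M + M₀ then a i * t ^ (M + M₀ - e i) else 0) =
      (∑ i ∈ s, a i * t ^ (M₀ - e i)) * t ^ M := by
  rw [Finset.sum_mul]
  refine Finset.sum_congr rfl fun i hi => ?_
  rw [if_pos ((he i hi).trans (Nat.le_add_left M₀ M)), Nat.add_sub_assoc (he i hi), pow_add]
  ring

/-- **Reversal identity**: for `t ≠ 0` and all `e_i ≤ M₀`,
`Σ_i a_i t^{M₀−e_i} = t^{M₀} Σ_i a_i (t⁻¹)^{e_i}`. [folklore] -/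
theorem sum_rev_eq {ι : Type*} (s : Finset ι) (a : ι → ℝ) (e : ι → ℕ) {t : ℝ} (ht : t ≠ 0)
    {M₀ : ℕ} (he : ∀ i ∈ s, e i ≤ M₀) :
    ∑ i ∈ s, a i * t ^ (M₀ - e i) = t ^ M₀ * ∑ i ∈ s, a i * t⁻¹ ^ e i := by
  rw [Finset.mul_sum]
  refine Finset.sum_congr rfl fun i hi => ?_
  rw [pow_sub₀ _ ht (he i hi), inv_pow]
  ring

/-! ### The open square and the polynomial `T = (α+βz₂)z₁` on it -/

/-- The open square `(0,1)²` has finite volume (it lies in the compact closed square). [folklore] -/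
theorem volume_sq_lt_top :
    volume (Set.pi Set.univ (fun _ : Fin 2 => Ioo (0 : ℝ) 1)) < ⊤ :=
  lt_of_le_of_lt (measure_mono fun _ hz =>
      (⟨fun i => ((mem_univ_pi.mp hz) i).1.le, fun i => ((mem_univ_pi.mp hz) i).2.le⟩ :
        _ ∈ Icc (0 : Fin 2 → ℝ) 1))
    isCompact_Icc.measure_lt_top

/-- On the open square every monomial `z^{d'}` lies in `[0,1]`. [folklore] -/
theorem monomial_bounds {z : Fin 2 → ℝ}
    (hz : z ∈ Set.pi Set.univ (fun _ : Fin 2 => Ioo (0 : ℝ) 1)) (d : Fin (2 + 1) →₀ ℕ) :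
    0 ≤ ∏ i : Fin 2, z i ^ d (Fin.castSucc i) ∧ ∏ i : Fin 2, z i ^ d (Fin.castSucc i) ≤ 1 :=
  ⟨Finset.prod_nonneg fun i _ => pow_nonneg ((mem_univ_pi.mp hz) i).1.le _,
    Finset.prod_le_one (fun i _ => pow_nonneg ((mem_univ_pi.mp hz) i).1.le _)
      fun i _ => pow_le_one₀ ((mem_univ_pi.mp hz) i).1.le ((mem_univ_pi.mp hz) i).2.le⟩

/-- On the closed square `[0,1]²`, `0 ≤ (α+βz₂)z₁ ≤ α+β` (`0 < α`, `0 < β`). [folklore] -/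
theorem T_bounds_Icc {α β : ℚ} (hα : 0 < α) (hβ : 0 < β) {z : Fin 2 → ℝ}
    (hz : z ∈ Icc (0 : Fin 2 → ℝ) 1) :
    0 ≤ ((α : ℝ) + β * z 1) * z 0 ∧ ((α : ℝ) + β * z 1) * z 0 ≤ (α : ℝ) + β := by
  have h0 : 0 ≤ z 0 := hz.1 0
  have h0' : z 0 ≤ 1 := hz.2 0
  have h1 : 0 ≤ z 1 := hz.1 1
  have h1' : z 1 ≤ 1 := hz.2 1
  have hβ' : (0 : ℝ) < β := by exact_mod_cast hβ
  have hw : (0 : ℝ) ≤ (α : ℝ) + β * z 1 :=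
    add_nonneg (by exact_mod_cast hα.le) (mul_nonneg hβ'.le h1)
  refine ⟨mul_nonneg hw h0, (mul_le_of_le_one_right hw h0').trans ?_⟩
  have h2 := mul_le_of_le_one_right hβ'.le h1'
  linarith

/-! ### Vanishing of the coefficients of a geometrically dominated expansion on the square -/

/-- **Term-wise integration and uniqueness.** Let `F_M` be continuous with `|F_M| ≤ K R^M` on the
open square (`0 < R`), and suppose that for every `ϖ ∈ (0,b)` (`0 < b`) one has `ϖR < 1`,
`Σ_M F_M(z) ϖ^M = g_ϖ(z)` on the square and `∫_□ g_ϖ = 0`. Then `∫_□ F_M = 0` for all `M`: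
dominated convergence for series (summable uniform domination `K(ϖR)^M`) gives
`Σ_M (∫_□ F_M) ϖ^M = 0` on `(0,b)` with `|∫_□ F_M| ≤ K·vol(□)·R^M`, so the sum of the formal power
series `(∫_□ F_M)_M` (radius `≥ 1/R`) is analytic at `0` with zeros accumulating at `0`, hence
the series is zero (isolated zeros, `HasFPowerSeriesAt.locally_zero_iff`). [folklore] -/
theorem integral_coeff_eq_zero {F : ℕ → (Fin 2 → ℝ) → ℝ} {g : ℝ → (Fin 2 → ℝ) → ℝ}
    {K R b : ℝ} (hR : 0 < R) (hb : 0 < b) (hF : ∀ M, Continuous (F M))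
    (hbd : ∀ M, ∀ z ∈ Set.pi Set.univ (fun _ : Fin 2 => Ioo (0 : ℝ) 1), |F M z| ≤ K * R ^ M)
    (hϖR : ∀ ϖ ∈ Ioo 0 b, ϖ * R < 1)
    (hlim : ∀ ϖ ∈ Ioo 0 b, ∀ z ∈ Set.pi Set.univ (fun _ : Fin 2 => Ioo (0 : ℝ) 1),
      HasSum (fun M => F M z * ϖ ^ M) (g ϖ z))
    (hg : ∀ ϖ ∈ Ioo 0 b, ∫ z in Set.pi Set.univ (fun _ : Fin 2 => Ioo (0 : ℝ) 1), g ϖ z = 0)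
    (M : ℕ) : ∫ z in Set.pi Set.univ (fun _ : Fin 2 => Ioo (0 : ℝ) 1), F M z = 0 := by
  have hsq : MeasurableSet (Set.pi Set.univ (fun _ : Fin 2 => Ioo (0 : ℝ) 1)) :=
    MeasurableSet.univ_pi fun _ => measurableSet_Ioo
  set μ : ℕ → ℝ := fun M => ∫ z in Set.pi Set.univ (fun _ : Fin 2 => Ioo (0 : ℝ) 1), F M z
    with hμ
  -- geometric bound on the coefficients
  have hμb : ∀ M, |μ M| ≤ K * (volume : Measure (Fin 2 → ℝ)).real
      (Set.pi Set.univ (fun _ : Fin 2 => Ioo (0 : ℝ) 1)) * R ^ M := fun M => by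
    have h := norm_setIntegral_le_of_norm_le_const volume_sq_lt_top
      fun z hz => (Real.norm_eq_abs _).trans_le (hbd M z hz)
    rw [Real.norm_eq_abs] at h
    refine h.trans (le_of_eq ?_)
    ring
  -- term-wise integration (dominated convergence for series)
  have hsum : ∀ ϖ ∈ Ioo 0 b, HasSum (fun M => μ M * ϖ ^ M) 0 := fun ϖ hϖ => by
    set q : ℝ := ϖ * R with hq
    have hq0 : 0 ≤ q := mul_nonneg hϖ.1.le hR.le
    have hq1 : q < 1 := hϖR ϖ hϖ
    rw [← hg ϖ hϖ]
    simp_rw [hμ, ← integral_mul_const]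
    refine hasSum_integral_of_dominated_convergence (fun M _ => K * q ^ M)
      (fun M => ?_) (fun M => ?_) ?_ ?_ ?_
    · exact ((hF M).mul continuous_const).aestronglyMeasurable
    · refine ae_restrict_of_forall_mem hsq fun z hz => ?_
      calc ‖F M z * ϖ ^ M‖ = |F M z| * ϖ ^ M := by
            rw [norm_mul, norm_pow, Real.norm_eq_abs, Real.norm_of_nonneg hϖ.1.le]
        _ ≤ K * R ^ M * ϖ ^ M := mul_le_mul_of_nonneg_right (hbd M z hz) (pow_nonneg hϖ.1.le M)
        _ = K * q ^ M := by rw [hq, mul_pow]; ring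
    · exact Filter.Eventually.of_forall fun z => (summable_geometric_of_lt_one hq0 hq1).mul_left _
    · simp_rw [tsum_mul_left, tsum_geometric_of_lt_one hq0 hq1]
      exact integrableOn_const volume_sq_lt_top.ne
    · exact ae_restrict_of_forall_mem hsq (hlim ϖ hϖ)
  -- uniqueness of the coefficients of a real power series vanishing on `(0,b)`
  set p : FormalMultilinearSeries ℝ ℝ ℝ := FormalMultilinearSeries.ofScalars ℝ μ with hp
  have hrad : ((Real.toNNReal R⁻¹ : NNReal) : ENNReal) ≤ p.radius := by
    refine p.le_radius_of_bound (K * (volume : Measure (Fin 2 → ℝ)).real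
      (Set.pi Set.univ (fun _ : Fin 2 => Ioo (0 : ℝ) 1))) fun n => ?_
    rw [hp, FormalMultilinearSeries.ofScalars_norm, Real.coe_toNNReal _ (inv_nonneg.mpr hR.le),
      Real.norm_eq_abs]
    calc |μ n| * R⁻¹ ^ n ≤ K * (volume : Measure (Fin 2 → ℝ)).real
          (Set.pi Set.univ (fun _ : Fin 2 => Ioo (0 : ℝ) 1)) * R ^ n * R⁻¹ ^ n :=
          mul_le_mul_of_nonneg_right (hμb n) (pow_nonneg (inv_nonneg.mpr hR.le) n)
      _ = _ := by rw [mul_assoc, ← mul_pow, mul_inv_cancel₀ hR.ne', one_pow, mul_one]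
  have hpos : 0 < p.radius := lt_of_lt_of_le (by simpa using hR) hrad
  have hps : HasFPowerSeriesOnBall p.sum p 0 p.radius := p.hasFPowerSeriesOnBall hpos
  have hzero : ∀ ϖ ∈ Ioo 0 (min b R⁻¹), p.sum ϖ = 0 := by
    intro ϖ hϖ
    have h1 : p.sum ϖ = ∑' n, μ n • ϖ ^ n := by
      rw [hp]
      exact FormalMultilinearSeries.ofScalars_sum_eq μ ϖ
    rw [h1]
    simp_rw [smul_eq_mul]
    exact (hsum ϖ ⟨hϖ.1, lt_of_lt_of_le hϖ.2 (min_le_left _ _)⟩).tsum_eq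
  have hfreq : ∃ᶠ z in 𝓝[≠] (0 : ℝ), p.sum z = 0 := by
    have hev : ∀ᶠ z in 𝓝[>] (0 : ℝ), p.sum z = 0 := by
      filter_upwards [Ioo_mem_nhdsGT (lt_min hb (inv_pos.mpr hR))] with z hz using hzero z hz
    exact hev.frequently.filter_mono (nhdsWithin_mono _ fun z hz => ne_of_gt hz)
  have hev : ∀ᶠ z in 𝓝 (0 : ℝ), p.sum z = 0 :=
    hps.analyticAt.frequently_zero_iff_eventually_zero.mp hfreq
  have hp0 : p = 0 := hps.hasFPowerSeriesAt.locally_zero_iff.mp hev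
  have hμ0 : μ = 0 := (FormalMultilinearSeries.ofScalars_series_eq_zero ℝ).mp (hp ▸ hp0)
  exact congrFun hμ0 M

end LinMomentsW

/-- STUB `stub_linMomentsW` (linear class, general numerator, step 1: MOMENTS of the reversed
polynomial). For `Q = 1 − ϖT`, `T = (α+βz₂)z₁` (`0 < α`, `0 < β`) non-vanishing on
`[0,1]² × (0,b)` and ANY `P = Σ_d c_d z^{d'} ϖ^{d_ϖ} ∈ ℚ[z₁,z₂,ϖ]` whose open-square fibre
integrals `∫_{(0,1)²} P/Q(·,ϖ)` vanish on `(0,b)`: with `M₀ = deg_ϖ P` and the REVERSED polynomial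
`P̃ := Σ_d c_d z^{d'} T^{M₀−d_ϖ} ∈ ℚ[z₁,z₂]` one has `P̃(z) = T^{M₀} P(z, 1/T)` wherever `T ≠ 0`
(`LinMomentsW.sum_rev_eq`), and every moment `∫_{(0,1)²} P̃ T^M` vanishes: admissibility gives
`ϖ(α+β) < 1` on `(0,b)`; expanding each monomial in its shifted geometric series,
`P/Q(z,ϖ) = Σ_M F_M(z) ϖ^M`, `F_M = Σ_{d_ϖ ≤ M} c_d z^{d'} T^{M−d_ϖ}`, with `|F_M| ≤ K(α+β)^M` on
the square (`LinMomentsW.hasSum_sum_shift`, `LinMomentsW.abs_sum_shift_le`); dominated convergence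
makes `Σ_M (∫F_M) ϖ^M = 0` on `(0,b)`, so all `∫ F_M = 0` (isolated zeros;
`LinMomentsW.integral_coeff_eq_zero`), and `F_{M+M₀} = P̃ T^M` (`LinMomentsW.sum_shift_eq`).
[cite: KontsevichZagier2001, §1.2] -/
theorem stub_linMomentsW (α β : ℚ) (P : MvPolynomial (Fin (2 + 1)) ℚ) (b : ℝ) (hα : 0 < α) (hβ : 0 < β)
    (hb : 0 < b)
    (hadm : ∀ (z : Fin 2 → ℝ) (ϖ : ℝ), (∀ t, z t ∈ Icc (0 : ℝ) 1) → ϖ ∈ Ioo 0 b →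
      aeval (Fin.snoc z ϖ : Fin (2 + 1) → ℝ)
        (1 - X (Fin.last 2) * (C α + C β * X 1) * X 0 : MvPolynomial (Fin (2 + 1)) ℚ) ≠ 0)
    (hvan : ∀ ϖ ∈ Ioo 0 b, ∫ z in Set.pi Set.univ (fun _ : Fin 2 => Ioo (0 : ℝ) 1),
      aeval (Fin.snoc z ϖ : Fin (2 + 1) → ℝ) P /
        aeval (Fin.snoc z ϖ : Fin (2 + 1) → ℝ)
          (1 - X (Fin.last 2) * (C α + C β * X 1) * X 0 : MvPolynomial (Fin (2 + 1)) ℚ) = 0) :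
    ∃ (M₀ : ℕ) (Pt : MvPolynomial (Fin 2) ℚ),
      (∀ z : Fin 2 → ℝ, ((α : ℝ) + β * z 1) * z 0 ≠ 0 →
        aeval z Pt = (((α : ℝ) + β * z 1) * z 0) ^ M₀ *
          aeval (Fin.snoc z ((((α : ℝ) + β * z 1) * z 0)⁻¹) : Fin (2 + 1) → ℝ) P) ∧
      ∀ M : ℕ, ∫ z in Set.pi Set.univ (fun _ : Fin 2 => Ioo (0 : ℝ) 1),
        aeval z Pt * (((α : ℝ) + β * z 1) * z 0) ^ M = 0 := by
  have hαβ : (0 : ℝ) < (α : ℝ) + β := by exact_mod_cast add_pos hα hβ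
  have he : ∀ d ∈ P.support, d (Fin.last 2) ≤ P.degreeOf (Fin.last 2) :=
    fun d hd => monomial_le_degreeOf _ hd
  refine ⟨P.degreeOf (Fin.last 2), ∑ d ∈ P.support, C (coeff d P) *
      (∏ i : Fin 2, X i ^ d (Fin.castSucc i)) *
        ((C α + C β * X 1) * X 0) ^ (P.degreeOf (Fin.last 2) - d (Fin.last 2)),
    fun z hz => ?_, fun M => ?_⟩
  · -- the reversal identity `P̃(z) = T^{M₀} P(z, 1/T)`
    rw [LinMomentsW.aeval_rev, LinMomentsW.aeval_snoc_eq_sum]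
    exact LinMomentsW.sum_rev_eq P.support
      (fun d => ((coeff d P : ℚ) : ℝ) * ∏ i : Fin 2, z i ^ d (Fin.castSucc i))
      (fun d => d (Fin.last 2)) hz he
  · -- `Q(z, ϖ) = 1 − ϖT(z)`
    have hden : ∀ (w : Fin 2 → ℝ) (ϖ : ℝ), aeval (Fin.snoc w ϖ : Fin (2 + 1) → ℝ)
        (1 - X (Fin.last 2) * (C α + C β * X 1) * X 0 : MvPolynomial (Fin (2 + 1)) ℚ) =
          1 - ϖ * (((α : ℝ) + β * w 1) * w 0) := fun w ϖ => by
      have h0 : (Fin.snoc w ϖ : Fin (2 + 1) → ℝ) 0 = w 0 := rfl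
      have h1 : (Fin.snoc w ϖ : Fin (2 + 1) → ℝ) 1 = w 1 := rfl
      simp only [map_sub, map_one, map_mul, map_add, aeval_X, aeval_C, Fin.snoc_last, h0, h1,
        eq_ratCast]
      ring
    -- admissibility bounds the parameter interval: `ϖ(α+β) < 1` on `(0,b)` (else the corner
    -- `z = (1,1)` and `ϖ₁ = 1/(α+β) ∈ (0,b)` give `Q = 0`)
    have hϖR : ∀ ϖ ∈ Ioo 0 b, ϖ * ((α : ℝ) + β) < 1 := fun ϖ hϖ => by
      refine not_le.mp fun h => ?_
      have hle : 1 / ((α : ℝ) + β) ≤ ϖ := (div_le_iff₀ hαβ).mpr h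
      refine hadm (fun _ => 1) _ (fun _ => ⟨zero_le_one, le_rfl⟩)
        ⟨one_div_pos.mpr hαβ, hle.trans_lt hϖ.2⟩ ?_
      rw [hden]
      simp only [mul_one]
      rw [one_div, inv_mul_cancel₀ hαβ.ne', sub_self]
    -- on the open square `0 ≤ T ≤ α + β`
    have hTb : ∀ z ∈ Set.pi Set.univ (fun _ : Fin 2 => Ioo (0 : ℝ) 1),
        0 ≤ ((α : ℝ) + β * z 1) * z 0 ∧ ((α : ℝ) + β * z 1) * z 0 ≤ (α : ℝ) + β := fun z hz =>
      LinMomentsW.T_bounds_Icc hα hβ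
        ⟨fun i => ((mem_univ_pi.mp hz) i).1.le, fun i => ((mem_univ_pi.mp hz) i).2.le⟩
    -- the uniform geometric bound `|F_M| ≤ K (α+β)^M` on the square
    have hFb : ∀ M : ℕ, ∀ z ∈ Set.pi Set.univ (fun _ : Fin 2 => Ioo (0 : ℝ) 1),
        |∑ d ∈ P.support, if d (Fin.last 2) ≤ M then
          ((coeff d P : ℚ) : ℝ) * (∏ i : Fin 2, z i ^ d (Fin.castSucc i)) *
            (((α : ℝ) + β * z 1) * z 0) ^ (M - d (Fin.last 2)) else 0| ≤
          (∑ d ∈ P.support, |((coeff d P : ℚ) : ℝ)| *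
            (((α : ℝ) + β) ^ d (Fin.last 2))⁻¹) * ((α : ℝ) + β) ^ M := fun M z hz =>
      LinMomentsW.abs_sum_shift_le P.support
        (fun d => ((coeff d P : ℚ) : ℝ) * ∏ i : Fin 2, z i ^ d (Fin.castSucc i))
        (fun d => |((coeff d P : ℚ) : ℝ)|) (fun d => d (Fin.last 2)) hαβ
        (hTb z hz).1 (hTb z hz).2
        (fun d _ => by
          rw [abs_mul]
          refine mul_le_of_le_one_right (abs_nonneg _) ?_
          rw [abs_of_nonneg (LinMomentsW.monomial_bounds hz d).1]
          exact (LinMomentsW.monomial_bounds hz d).2) M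
    -- the coefficients `∫ F_M` of the expansion of the (vanishing) fibre integral all vanish
    have hν : ∀ M : ℕ, (∫ z in Set.pi Set.univ (fun _ : Fin 2 => Ioo (0 : ℝ) 1),
        ∑ d ∈ P.support, if d (Fin.last 2) ≤ M then
          ((coeff d P : ℚ) : ℝ) * (∏ i : Fin 2, z i ^ d (Fin.castSucc i)) *
            (((α : ℝ) + β * z 1) * z 0) ^ (M - d (Fin.last 2)) else 0) = 0 := by
      refine LinMomentsW.integral_coeff_eq_zero
        (F := fun M z => ∑ d ∈ P.support, if d (Fin.last 2) ≤ M then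
          ((coeff d P : ℚ) : ℝ) * (∏ i : Fin 2, z i ^ d (Fin.castSucc i)) *
            (((α : ℝ) + β * z 1) * z 0) ^ (M - d (Fin.last 2)) else 0)
        (g := fun ϖ z => aeval (Fin.snoc z ϖ : Fin (2 + 1) → ℝ) P /
          (1 - ϖ * (((α : ℝ) + β * z 1) * z 0)))
        (K := ∑ d ∈ P.support, |((coeff d P : ℚ) : ℝ)| * (((α : ℝ) + β) ^ d (Fin.last 2))⁻¹)
        hαβ hb (fun M => ?_) hFb hϖR (fun ϖ hϖ z hz => ?_) fun ϖ hϖ => ?_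
      · refine continuous_finsetSum _ fun d _ => ?_
        split_ifs
        · fun_prop
        · exact continuous_const
      · have hT := hTb z hz
        rw [LinMomentsW.aeval_snoc_eq_sum, div_eq_mul_inv]
        exact LinMomentsW.hasSum_sum_shift P.support
          (fun d => ((coeff d P : ℚ) : ℝ) * ∏ i : Fin 2, z i ^ d (Fin.castSucc i))
          (fun d => d (Fin.last 2)) (mul_nonneg hϖ.1.le hT.1)
          (lt_of_le_of_lt (mul_le_mul_of_nonneg_left hT.2 hϖ.1.le) (hϖR ϖ hϖ))
      · have h0 := hvan ϖ hϖ
        simp only [hden] at h0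
        exact h0
    -- the `(M + M₀)`-th coefficient is the `M`-th moment of `P̃`
    refine Eq.trans ?_ (hν (M + P.degreeOf (Fin.last 2)))
    congr 1
    funext z
    rw [LinMomentsW.aeval_rev]
    exact (LinMomentsW.sum_shift_eq P.support
      (fun d => ((coeff d P : ℚ) : ℝ) * ∏ i : Fin 2, z i ^ d (Fin.castSucc i))
      (fun d => d (Fin.last 2)) (((α : ℝ) + β * z 1) * z 0) he M).symm

end Summit.KontsevichZagierPeriods.InverseLandau.TateFamilyKernel.Descent
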